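import Literature.Probability.RandomPlanarGeometry.HexSAWPolygonCountRatio
import Literature.Probability.RandomPlanarGeometry.HexSAWPolygonConcatenation
import Literature.Probability.RandomPlanarGeometry.SAWEndpointRateLowerInsertion
import HarnessLib

/-!
# Kesten's LOWER ratio rate for honeycomb polygons:
# `(2+√2) − p_{2m+4}(ℍ)/p_{2m+2}(ℍ) ≤ K·m^{-1/3}`, hence (7.5.2) two-sided on `ℍ` («HEX-POLYGON-RATE-⅓»)

Topic `Literature/Probability/RandomPlanarGeometry` (lane «pcv-sawmu», a-p4 g8; assembles
`HexSAWPolygonConcatenation.lean` — the brick join `HexBW.PolygonConcat.endAtCount_mul_le :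
c_n(0,e₀;ℍ) · c_m(0,e₀;ℍ) ≤ 2nm · c_{n+m+3}(0,e₀;ℍ)` —, `HexSAWEndpointRatioRate.lean` — the spliced sequence
`HV.spliceE` with `spliceE_pos`, `spliceE_additive_all` (Kesten's (7.3.3) along the parity class, additive form) —,
`HexSAWPolygonRatio.lean` / `HexSAWPolygonCountRatio.lean` — the unconditional envelope `HV.hexAdjEndLo`, the limit
`HV.hexPolygonRatioTwo`, the upper rate `hexPolygonCountRatioTwo_upperRate` and the normalisation
`hexPolygonCount (N+1) = #E_N(nb2)` —, and the tree's abstract engine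
`Zd.KestenRateLower.lower_rate_cubeRoot_ins` of `SAWEndpointRateLowerInsertion.lean`).

Source: N. Madras, G. Slade, *The Self-Avoiding Walk* (1993), §7.5, eq. (7.5.2) p. 255 (Kesten 1963): for fixed `x ≠ 0`,
"`−K N^{−1/3} ≤ c_{N+2}(0,x)/c_N(0,x) − μ² ≤ K N^{−1/4}`", and Theorem 7.3.4 (c) p. 248 (the polygon ratio) — `ℤ^d`,
(7.5.2) stated without proof; tree twin with both rates in every dimension: `Zd.MadrasSlade1993_thm734c_rate`
(`SAWPolygonRatioRateZd.lean`).  THIS FILE proves the LOWER half (exponent `1/3`) on the honeycomb lattice for polygons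
(walks from the origin to a fixed NEIGHBOUR `z`, i.e. rooted polygons through the bond `{0,z}`), with NO hypotheses, and
packages the two-sided statement in the printed shape.  Status in print for `ℍ`: nothing located (lane lit cells;
the honeycomb polygon concatenation is asserted/used but not proved in print — the tree's `HexSAWPolygonConcatenation`
supplies it); label «CONSOLIDATION-with-rate — Kesten's ⅓ lower rate carried to `ℍ`; first written + kernel text».

## Mechanism (no new idea)

The engine `lower_rate_cubeRoot_ins` wants, for a positive sequence `a` with Kesten's additive inequality for all
`n ≥ 1`, an auxiliary sequence `e_M` with `e^{−c√M} μ^{2M} ≤ A e_M` (`M ≥ 2`) and the insertion inequality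
`a_{N'} e_M ≤ (2(N'+2M)+3)^6 a_{N'+2M}` (`N' ≥ n₁` odd, `M ≥ 2`).  Take `a := spliceE z 1 N₀` (fixed-endpoint counts on the
odd class beyond the envelope threshold, all-walk counts elsewhere — the device of `HexSAWEndpointRatioRate.lean`) and
`e_M := max(1, #E_{2M−3}(z))` for `M ≥ 3`, `e_2 := 1`: when `#E_{2M−3}(z) ≥ 1` the insertion inequality IS the brick join
(rooted `(N'+1)`-gon ⊕ rooted `(2M−2)`-gon ↦ rooted `(N'+2M+1)`-gon, polygon-length shift `+2`, multiplicity
`2N'(2M−3) ≤ (2(N'+2M)+3)^6`); when `#E_{2M−3}(z) = 0` (on `ℍ`: `M = 3, 5`, no `4`- or `8`-gons) or `M = 2` it is the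
EVENTUAL MONOTONICITY `#E_{N'}(z) ≤ #E_{N'+2M}(z)` along the odd class, which follows from the ratio limit `2 + √2 > 1`
(`hexPolygonRatioTwo`); the envelope of `e` is the polygon envelope `hexAdjEndLo` three steps down (`c ↦ 2c`, `A = μ_ℍ^{2m₀+7}`).

## Contents (namespace `Literature.Probability.RandomPlanarGeometry.SAW.HV`; all PROVED, axioms standard, NO hypotheses)

* `card_endFin_eq_nb2`, `card_endFin_nb2_eq_endAtCount`, **`card_endFin_mul_le`** (the brick join in the `HV` frame:
  `#E_n(z) · #E_m(z) ≤ 2nm · #E_{n+m+3}(z)` for a neighbour `z` of the origin, `n, m ≥ 2`);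
* `endFin_eventually_mono`, `endFin_eventually_mono_iter` (eventual monotonicity along the odd class);
* **`hexPolygonRatioTwo_lowerRate (hz) : ∃ K m₁, ∀ m ≥ m₁, (2+√2) − #E_{2m+3}(z)/#E_{2m+1}(z) ≤ K·m^{−1/3}`**;
* **`hexPolygonCountRatioTwo_lowerRate`**, **`hexPolygonCountRatioTwo_rate`**:
  `−K m^{−1/3} ≤ p_{2m+4}(ℍ)/p_{2m+2}(ℍ) − (2+√2) ≤ K m^{−1/4}` for all large `m` (the `ℍ` twin of
  `Zd.MadrasSlade1993_thm734c_rate`, `p_N(ℍ) = hexPolygonCount N`).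
-/

noncomputable section

open Finset Filter Topology Literature.Probability.LatticeModels SimpleGraph

namespace Literature.Probability.RandomPlanarGeometry.SAW.HV

/-! ### The brick join in the `HV` frame -/

section Concat

/-- All three neighbours of the origin have the same fixed-endpoint counts (order-3 rotation). [cite: MadrasSlade1993, §1.1 (lattice symmetry of `c_n(0,x)`)] -/
theorem card_endFin_eq_nb2 {z : HV} (hz : hvGraph.Adj hvOrigin z) (N : ℕ) : #(endFin z N) = #(endFin nb2 N) := by
  rcases (adj_hvOrigin_iff z).1 hz with rfl | rfl | rfl
  · exact (card_endFin_nb2 N).symm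
  · rw [card_endFin_nb1, card_endFin_nb2]
  · rfl

/-- `#E_N(nb2) = c_N(0,e₀;ℍ)` in the brick-wall frame (`hvToBW nb2 = e₀`). [cite: EntingJensen2009, §7.4.2, Fig. 7.10 (brick-wall form of the hexagonal lattice)] -/
theorem card_endFin_nb2_eq_endAtCount (N : ℕ) : #(endFin nb2 N) = HexBW.endAtCount N (Pi.single 0 1) := by
  rw [card_endFin_eq_card_bw, hvToBW_nb2]
  rfl

/-- **Concatenation of rooted honeycomb polygons, `HV` frame**: for a neighbour `z` of the origin and `n, m ≥ 2`,
`#E_n(z) · #E_m(z) ≤ 2nm · #E_{n+m+3}(z)` (rooted `(n+1)`- and `(m+1)`-gons through `{0,z}` ↦ rooted `(n+m+4)`-gons).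
[cite: MadrasSlade1993, Theorem 3.2.3, eq. (3.2.2), p. 64] -/
theorem card_endFin_mul_le {z : HV} (hz : hvGraph.Adj hvOrigin z) {n m : ℕ} (hn : 2 ≤ n) (hm : 2 ≤ m) :
    #(endFin z n) * #(endFin z m) ≤ 2 * n * m * #(endFin z (n + m + 3)) := by
  rw [card_endFin_eq_nb2 hz, card_endFin_eq_nb2 hz, card_endFin_eq_nb2 hz, card_endFin_nb2_eq_endAtCount,
    card_endFin_nb2_eq_endAtCount, card_endFin_nb2_eq_endAtCount]
  exact HexBW.PolygonConcat.endAtCount_mul_le hn hm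

end Concat

/-! ### Eventual monotonicity along the odd class -/

section Mono

/-- **Eventual positivity and monotonicity**: for a neighbour `z` of the origin, `0 < #E_{2m+1}(z) ≤ #E_{2m+3}(z)` for all
large `m` (the ratio tends to `2 + √2 > 1`). [cite: MadrasSlade1993, Theorem 7.3.4 (c) p. 248] -/
theorem endFin_eventually_mono {z : HV} (hz : hvGraph.Adj hvOrigin z) :
    ∃ m₀ : ℕ, ∀ m : ℕ, m₀ ≤ m → 0 < #(endFin z (2 * m + 1)) ∧ #(endFin z (2 * m + 1)) ≤ #(endFin z (2 * m + 1 + 2)) := by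
  obtain ⟨m₁, hm₁⟩ := hexEndpointLo_of_adjEndLo hexAdjEndLo hz
  have hlim := hexPolygonRatioTwo hz
  have hgt : ∀ᶠ m : ℕ in atTop, (1 : ℝ) < (#(endFin z (2 * m + 1 + 2)) : ℝ) / #(endFin z (2 * m + 1)) :=
    hlim.eventually (eventually_gt_nhds (by
      have := Real.sqrt_nonneg 2
      linarith))
  obtain ⟨m₂, hm₂⟩ := Filter.eventually_atTop.1 hgt
  have hμ := hexConnectiveConstant_pos
  refine ⟨max m₁ m₂, fun m hm => ?_⟩
  have h1 := hm₁ m (le_trans (le_max_left _ _) hm)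
  have h2 := hm₂ m (le_trans (le_max_right _ _) hm)
  have hpos : (0 : ℝ) < #(endFin z (2 * m + 1)) := lt_of_lt_of_le (by positivity) h1
  have hposN : 0 < #(endFin z (2 * m + 1)) := by exact_mod_cast hpos
  refine ⟨hposN, ?_⟩
  rw [lt_div_iff₀ hpos, one_mul] at h2
  exact_mod_cast h2.le

/-- Iterated form: `#E_{2m+1}(z) ≤ #E_{2m+1+2M}(z)` for all large `m` and every `M`. [cite: MadrasSlade1993, Theorem 7.3.4 (c) p. 248] -/
theorem endFin_eventually_mono_iter {z : HV} (hz : hvGraph.Adj hvOrigin z) :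
    ∃ m₀ : ℕ, ∀ m : ℕ, m₀ ≤ m → ∀ M : ℕ, #(endFin z (2 * m + 1)) ≤ #(endFin z (2 * m + 1 + 2 * M)) := by
  obtain ⟨m₀, hm₀⟩ := endFin_eventually_mono hz
  refine ⟨m₀, fun m hm M => ?_⟩
  induction M with
  | zero => simp
  | succ M ih =>
    have h := (hm₀ (m + M) (by omega)).2
    rw [show 2 * (m + M) + 1 = 2 * m + 1 + 2 * M by ring] at h
    rw [show 2 * m + 1 + 2 * (M + 1) = 2 * m + 1 + 2 * M + 2 by ring]
    exact ih.trans h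

end Mono

/-! ### The lower rate -/

section Rate

/-- `e^{−2c√M} ≤ e^{−c√(2M−3)}` for `c ≥ 0`, `M ≥ 2` (as reals, `2M − 3` written `2(M−2)+1`). [folklore] -/
private theorem exp_two_le {c : ℝ} (hc : 0 ≤ c) {M : ℕ} (hM : 2 ≤ M) :
    Real.exp (-(2 * c * Real.sqrt (M : ℝ))) ≤ Real.exp (-(c * Real.sqrt ((2 * (M - 2) + 1 : ℕ) : ℝ))) := by
  rw [Real.exp_le_exp, neg_le_neg_iff]
  have hMr : (2 : ℝ) ≤ M := by exact_mod_cast hM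
  have hcast : ((2 * (M - 2) + 1 : ℕ) : ℝ) ≤ 2 * (M : ℝ) + 1 := by
    have h : (2 * (M - 2) + 1 : ℕ) ≤ 2 * M + 1 := by omega
    exact_mod_cast h
  have h1 : Real.sqrt ((2 * (M - 2) + 1 : ℕ) : ℝ) ≤ 2 * Real.sqrt (M : ℝ) := by
    rw [show (2 : ℝ) * Real.sqrt (M : ℝ) = Real.sqrt (4 * (M : ℝ)) by
      rw [show (4 : ℝ) * M = 2 ^ 2 * M by ring, Real.sqrt_mul (by norm_num), Real.sqrt_sq (by norm_num)]]
    exact Real.sqrt_le_sqrt (by linarith)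
  calc c * Real.sqrt ((2 * (M - 2) + 1 : ℕ) : ℝ) ≤ c * (2 * Real.sqrt (M : ℝ)) := mul_le_mul_of_nonneg_left h1 hc
    _ = 2 * c * Real.sqrt (M : ℝ) := by ring

/-- The multiplicity of the brick join is below the engine's polynomial: `2 n r ≤ (2(n + 2M) + 3)^6` when `0 ≤ n`, `r ≤ 2M+1`.
[folklore] -/
private theorem two_mul_mul_le_pow_six {n r M : ℝ} (hn : 0 ≤ n) (hM : 0 ≤ M) (hrM : r ≤ 2 * M + 1) :
    2 * n * r ≤ (2 * (n + 2 * M) + 3) ^ 6 := by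
  set L : ℝ := 2 * (n + 2 * M) + 3 with hL
  have hL1 : 1 ≤ L := by rw [hL]; nlinarith
  have h2 : 2 * n * r ≤ L ^ 2 := by rw [hL]; nlinarith
  exact h2.trans (pow_le_pow_right₀ hL1 (by norm_num))

/-- **The polygon LOWER rate on `ℍ`, NO hypotheses**: for each neighbour `z` of the origin,
`(2+√2) − #E_{2m+3}(z)/#E_{2m+1}(z) ≤ K·m^{−1/3}` for all large `m` (rooted `(2m+4)`-gons over rooted `(2m+2)`-gons through
the edge `{0,z}`): Kesten's exponent `1/3` via the brick join and eventual monotonicity.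
[cite: MadrasSlade1993, §7.5 eq. (7.5.2) p. 255 and Theorem 7.3.4 (c) p. 248] [cite: Kesten1963SAW, §4] [cite: DuminilCopinSmirnov2012, Theorem 1] -/
theorem hexPolygonRatioTwo_lowerRate {z : HV} (hz : hvGraph.Adj hvOrigin z) :
    ∃ K : ℝ, ∃ m₁ : ℕ, ∀ m : ℕ, m₁ ≤ m →
      (2 + Real.sqrt 2) - (#(endFin z (2 * m + 1 + 2)) : ℝ) / #(endFin z (2 * m + 1)) ≤ K * (m : ℝ) ^ (-(1 : ℝ) / 3) := by
  -- the envelope and its constant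
  set c₀ : ℝ := Real.log 27060804 + 2 * (6 : ℕ) + 30 + 2 with hc₀def
  have hLo : HexEndpointLo z c₀ 1 := hexEndpointLo_of_adjEndLo hexAdjEndLo hz
  have hc₀ : (0 : ℝ) ≤ c₀ := by
    have := Real.log_nonneg (show (1 : ℝ) ≤ 27060804 by norm_num); positivity
  obtain ⟨m₀, hm₀⟩ := hLo
  obtain ⟨m₁, hmono⟩ := endFin_eventually_mono_iter hz
  -- the spliced sequence
  set N₀ := 2 * m₀ + 1 with hN₀
  set a : ℕ → ℝ := spliceE z 1 N₀ with ha
  have hapos : ∀ n, 0 < a n := spliceE_pos hc₀ le_rfl hm₀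
  obtain ⟨B, hB1, hK⟩ := spliceE_additive_all le_rfl hc₀ ⟨m₀, hm₀⟩ hm₀
  have hμ1 : (1 : ℝ) ≤ hexConnectiveConstant := one_le_hexConnectiveConstant
  have hμ0 : (0 : ℝ) < hexConnectiveConstant := hexConnectiveConstant_pos
  -- enlarge `B` so that `μ² ≤ B`
  set B' : ℝ := max B (hexConnectiveConstant ^ 2) with hB'
  have hB1' : 1 ≤ B' := le_trans hB1 (le_max_left _ _)
  have hBμ' : hexConnectiveConstant ^ 2 ≤ B' := le_max_right _ _
  have hK' : ∀ n : ℕ, 1 ≤ n → a (n + 2) / a n - B' / n ≤ a (n + 4) / a (n + 2) := by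
    intro n hn
    have h1 := hK n hn
    have hn0 : (0 : ℝ) < n := by exact_mod_cast hn
    have : B / n ≤ B' / n := div_le_div_of_nonneg_right (le_max_left _ _) hn0.le
    linarith
  -- the auxiliary sequence `e`
  set e : ℕ → ℝ := fun M => if M ≤ 2 then 1 else max 1 (#(endFin z (2 * (M - 2) + 1)) : ℝ) with he
  have he1 : ∀ M, 1 ≤ e M := by
    intro M; simp only [he]; split_ifs
    · exact le_rfl
    · exact le_max_left _ _
  set A : ℝ := hexConnectiveConstant ^ (2 * m₀ + 7) with hA
  have hA1 : 1 ≤ A := one_le_pow₀ hμ1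
  have hlo : ∀ M : ℕ, 2 ≤ M → Real.exp (-(2 * c₀ * Real.sqrt M)) * hexConnectiveConstant ^ (2 * M) ≤ A * e M := by
    intro M hM
    by_cases hbig : m₀ + 3 ≤ M
    · -- the polygon envelope at length `2M − 3 = 2(M−2)+1`
      have h1 := hm₀ (M - 2) (by omega)
      have hM3 : ¬ M ≤ 2 := by omega
      have hE : (#(endFin z (2 * (M - 2) + 1)) : ℝ) ≤ e M := by
        simp only [he, if_neg hM3]; exact le_max_right _ _
      have hpow : hexConnectiveConstant ^ (2 * M) = hexConnectiveConstant ^ 3 * hexConnectiveConstant ^ (2 * (M - 2) + 1) := by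
        rw [← pow_add]; congr 1; omega
      have h3 : hexConnectiveConstant ^ 3 ≤ A := pow_le_pow_right₀ hμ1 (by omega)
      calc Real.exp (-(2 * c₀ * Real.sqrt M)) * hexConnectiveConstant ^ (2 * M)
          ≤ Real.exp (-(c₀ * Real.sqrt ((2 * (M - 2) + 1 : ℕ) : ℝ))) * hexConnectiveConstant ^ (2 * M) :=
            mul_le_mul_of_nonneg_right (exp_two_le hc₀ hM) (by positivity)
        _ = hexConnectiveConstant ^ 3 *
              (Real.exp (-(c₀ * Real.sqrt ((2 * (M - 2) + 1 : ℕ) : ℝ))) * hexConnectiveConstant ^ (2 * (M - 2) + 1)) := by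
            rw [hpow]; ring
        _ ≤ A * e M := mul_le_mul h3 (h1.trans hE) (by positivity) (by positivity)
    · -- finitely many small `M`: absorbed in `A`
      have h1 : Real.exp (-(2 * c₀ * Real.sqrt M)) ≤ 1 := by
        rw [Real.exp_le_one_iff]; have := Real.sqrt_nonneg (M : ℝ); nlinarith
      have h2 : hexConnectiveConstant ^ (2 * M) ≤ A := pow_le_pow_right₀ hμ1 (by omega)
      calc Real.exp (-(2 * c₀ * Real.sqrt M)) * hexConnectiveConstant ^ (2 * M)
          ≤ 1 * A := mul_le_mul h1 h2 (by positivity) zero_le_one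
        _ ≤ A * e M := by rw [one_mul]; exact le_mul_of_one_le_right (by positivity) (he1 M)
  -- the insertion inequality
  set n₁ : ℕ := 2 * (m₀ + m₁ + 1) + 1 with hn₁
  have hSM : ∀ N' M : ℕ, n₁ ≤ N' → N' % 2 = 1 → 2 ≤ M →
      a N' * e M ≤ (2 * ((N' : ℝ) + 2 * M) + 3) ^ 6 * a (N' + 2 * M) := by
    intro N' M hN' hpar hM
    obtain ⟨m, rfl⟩ : ∃ m, N' = 2 * m + 1 := ⟨N' / 2, by omega⟩
    have hm0 : m₀ ≤ m := by omega
    have hm1 : m₁ ≤ m := by omega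
    have eN : a (2 * m + 1) = #(endFin z (2 * m + 1)) := spliceE_of_class ⟨by omega, by omega⟩
    have eNM : a (2 * m + 1 + 2 * M) = #(endFin z (2 * m + 1 + 2 * M)) := spliceE_of_class ⟨by omega, by omega⟩
    have hxr : (0 : ℝ) ≤ ((2 * m + 1 : ℕ) : ℝ) := Nat.cast_nonneg _
    have hMr : (0 : ℝ) ≤ (M : ℝ) := Nat.cast_nonneg _
    have hP1 : (1 : ℝ) ≤ (2 * (((2 * m + 1 : ℕ) : ℝ) + 2 * M) + 3) ^ 6 := one_le_pow₀ (by linarith)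
    have hmonoR : (#(endFin z (2 * m + 1)) : ℝ) ≤ #(endFin z (2 * m + 1 + 2 * M)) := by
      exact_mod_cast hmono m hm1 M
    by_cases hcase : ¬ M ≤ 2 ∧ (1 : ℝ) ≤ #(endFin z (2 * (M - 2) + 1))
    · -- the brick join
      obtain ⟨hM3, hE1⟩ := hcase
      have heM : e M = #(endFin z (2 * (M - 2) + 1)) := by
        simp only [he, if_neg hM3]; exact max_eq_right hE1
      have hG := card_endFin_mul_le hz (n := 2 * m + 1) (m := 2 * (M - 2) + 1) (by omega) (by omega)
      rw [show 2 * m + 1 + (2 * (M - 2) + 1) + 3 = 2 * m + 1 + 2 * M by omega] at hG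
      have hGR : (#(endFin z (2 * m + 1)) : ℝ) * #(endFin z (2 * (M - 2) + 1)) ≤
          (2 * ((2 * m + 1 : ℕ) : ℝ) * ((2 * (M - 2) + 1 : ℕ) : ℝ)) * #(endFin z (2 * m + 1 + 2 * M)) := by
        exact_mod_cast hG
      have hfac : 2 * ((2 * m + 1 : ℕ) : ℝ) * ((2 * (M - 2) + 1 : ℕ) : ℝ) ≤
          (2 * (((2 * m + 1 : ℕ) : ℝ) + 2 * M) + 3) ^ 6 := by
        have hr : ((2 * (M - 2) + 1 : ℕ) : ℝ) ≤ 2 * (M : ℝ) + 1 := by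
          have h : (2 * (M - 2) + 1 : ℕ) ≤ 2 * M + 1 := by omega
          exact_mod_cast h
        exact two_mul_mul_le_pow_six hxr hMr hr
      rw [eN, eNM, heM]
      exact hGR.trans (mul_le_mul_of_nonneg_right hfac (by positivity))
    · -- `e M = 1`: eventual monotonicity
      have heM : e M = 1 := by
        simp only [he]
        split_ifs with h
        · rfl
        · rw [not_and_or, not_not, not_le] at hcase
          rcases hcase with h' | h'
          · exact absurd h' h
          · exact max_eq_left h'.le
      rw [heM, mul_one, eN, eNM]
      calc (#(endFin z (2 * m + 1)) : ℝ) ≤ #(endFin z (2 * m + 1 + 2 * M)) := hmonoR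
        _ ≤ (2 * (((2 * m + 1 : ℕ) : ℝ) + 2 * M) + 3) ^ 6 * #(endFin z (2 * m + 1 + 2 * M)) :=
          le_mul_of_one_le_left (by positivity) hP1
  -- the engine
  have hc2 : (0 : ℝ) ≤ 2 * c₀ := by positivity
  obtain ⟨K, hKrate⟩ := Zd.KestenRateLower.lower_rate_cubeRoot_ins (a := a) (e := e) (μ := hexConnectiveConstant)
    (B := B') (c := 2 * c₀) (A := A) (n₁ := n₁) (r := 1) hapos hμ1 hB1' hBμ' hc2 hA1 hK' hlo hSM
  refine ⟨max K 0, n₁, fun m hm => ?_⟩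
  set N := 2 * m + 1 with hN
  have hN1 : 2 * n₁ + 1 ≤ N := by omega
  have hm1 : 1 ≤ m := by omega
  have eN : a N = #(endFin z N) := spliceE_of_class ⟨by omega, by omega⟩
  have eN2 : a (N + 2) = #(endFin z (N + 2)) := spliceE_of_class ⟨by omega, by omega⟩
  have hsq : hexConnectiveConstant ^ 2 = 2 + Real.sqrt 2 := hexConnectiveConstant_sq
  have hmr : (0 : ℝ) < m := by exact_mod_cast (show 0 < m by omega)
  have hrpow0 : (0 : ℝ) ≤ (m : ℝ) ^ (-(1 : ℝ) / 3) := Real.rpow_nonneg hmr.le _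
  set u : ℝ := (2 + Real.sqrt 2) - (#(endFin z (N + 2)) : ℝ) / #(endFin z N) with hu
  show u ≤ max K 0 * (m : ℝ) ^ (-(1 : ℝ) / 3)
  rcases le_or_gt u 0 with hu0 | hu0
  · exact hu0.trans (mul_nonneg (le_max_right _ _) hrpow0)
  have hdev : a (N + 2) / a N ≤ hexConnectiveConstant ^ 2 - u := by
    rw [eN, eN2, hsq, hu]; linarith
  have h1 := hKrate N hN1 (by omega) u hu0 hdev
  have hmN : (m : ℝ) ≤ N := by exact_mod_cast (show m ≤ N by omega)
  have hNr : (0 : ℝ) < N := by linarith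
  have hanti : (N : ℝ) ^ (-(1 : ℝ) / 3) ≤ (m : ℝ) ^ (-(1 : ℝ) / 3) := by
    rw [show (-(1 : ℝ) / 3) = -((1 : ℝ) / 3) by ring, Real.rpow_neg hNr.le, Real.rpow_neg hmr.le]
    exact inv_anti₀ (Real.rpow_pos_of_pos hmr _) (Real.rpow_le_rpow hmr.le hmN (by norm_num))
  calc u ≤ K * (N : ℝ) ^ (-(1 : ℝ) / 3) := h1
    _ ≤ max K 0 * (N : ℝ) ^ (-(1 : ℝ) / 3) := mul_le_mul_of_nonneg_right (le_max_left _ _) (Real.rpow_nonneg hNr.le _)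
    _ ≤ max K 0 * (m : ℝ) ^ (-(1 : ℝ) / 3) := mul_le_mul_of_nonneg_left hanti (le_max_right _ _)

/-- **(7.5.2) for honeycomb polygons, per neighbour, both sides, NO hypotheses**: for each neighbour `z` of the origin and all
large `m`, `−K m^{−1/3} ≤ #E_{2m+3}(z)/#E_{2m+1}(z) − (2+√2) ≤ K m^{−1/4}`.
[cite: MadrasSlade1993, §7.5 eq. (7.5.2) p. 255 and Theorem 7.3.4 (c) p. 248] [cite: Kesten1963SAW, §4] [cite: DuminilCopinSmirnov2012, Theorem 1] -/
theorem hexPolygonRatioTwo_rate {z : HV} (hz : hvGraph.Adj hvOrigin z) :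
    ∃ K : ℝ, ∃ m₁ : ℕ, ∀ m : ℕ, m₁ ≤ m →
      -K * (m : ℝ) ^ (-(1 : ℝ) / 3) ≤ (#(endFin z (2 * m + 1 + 2)) : ℝ) / #(endFin z (2 * m + 1)) - (2 + Real.sqrt 2) ∧
      (#(endFin z (2 * m + 1 + 2)) : ℝ) / #(endFin z (2 * m + 1)) - (2 + Real.sqrt 2) ≤ K * (m : ℝ) ^ (-(1 : ℝ) / 4) := by
  obtain ⟨K₁, m₁, h₁⟩ := hexPolygonRatioTwo_lowerRate hz
  obtain ⟨K₂, m₂, h₂⟩ := hexPolygonRatioTwo_upperRate hz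
  refine ⟨max K₁ K₂, max m₁ m₂, fun m hm => ⟨?_, ?_⟩⟩
  · have h := h₁ m (le_trans (le_max_left _ _) hm)
    have h0 : (0 : ℝ) ≤ (m : ℝ) ^ (-(1 : ℝ) / 3) := Real.rpow_nonneg (Nat.cast_nonneg m) _
    have : K₁ * (m : ℝ) ^ (-(1 : ℝ) / 3) ≤ max K₁ K₂ * (m : ℝ) ^ (-(1 : ℝ) / 3) :=
      mul_le_mul_of_nonneg_right (le_max_left _ _) h0
    linarith
  · have h := h₂ m (le_trans (le_max_right _ _) hm)
    have h0 : (0 : ℝ) ≤ (m : ℝ) ^ (-(1 : ℝ) / 4) := Real.rpow_nonneg (Nat.cast_nonneg m) _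
    exact h.trans (mul_le_mul_of_nonneg_right (le_max_right _ _) h0)

/-- **The polygon LOWER rate on `ℍ`, verbatim normalisation, NO hypotheses**: `(2+√2) − p_{2m+4}(ℍ)/p_{2m+2}(ℍ) ≤ K·m^{−1/3}` for all
large `m` (`p_N(ℍ) = hexPolygonCount N`). [cite: MadrasSlade1993, §7.5 eq. (7.5.2) p. 255 and Theorem 7.3.4 (c) p. 248]
[cite: Kesten1963SAW, §4] [cite: DuminilCopinSmirnov2012, Theorem 1] -/
theorem hexPolygonCountRatioTwo_lowerRate :
    ∃ K : ℝ, ∃ m₁ : ℕ, ∀ m : ℕ, m₁ ≤ m →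
      (2 + Real.sqrt 2) - (hexPolygonCount (2 * m + 4) : ℝ) / hexPolygonCount (2 * m + 2) ≤ K * (m : ℝ) ^ (-(1 : ℝ) / 3) := by
  have hnb2 : hvGraph.Adj hvOrigin nb2 := (adj_hvOrigin_iff nb2).2 (Or.inr (Or.inr rfl))
  obtain ⟨K, m₁, h⟩ := hexPolygonRatioTwo_lowerRate hnb2
  refine ⟨K, m₁, fun m hm => ?_⟩
  rw [show 2 * m + 4 = (2 * m + 1 + 2) + 1 by ring, show 2 * m + 2 = (2 * m + 1) + 1 by ring,
    hexPolygonCount_eq_card_endFin, hexPolygonCount_eq_card_endFin]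
  exact h m hm

/-- **Kesten's (7.5.2) for honeycomb polygons — Madras–Slade Theorem 7.3.4 (c) on `ℍ` WITH BOTH RATES, NO hypotheses**:
`−K m^{−1/3} ≤ p_{2m+4}(ℍ)/p_{2m+2}(ℍ) − (2+√2) ≤ K m^{−1/4}` for all large `m` (`p_N(ℍ) = hexPolygonCount N`, the rooted oriented
`N`-gons through the bond `{0,e₀}`; `μ_ℍ² = 2 + √2` by Duminil-Copin–Smirnov).  The `ℤ^d` twin is `Zd.MadrasSlade1993_thm734c_rate`.
[cite: MadrasSlade1993, §7.5 eq. (7.5.2) p. 255 and Theorem 7.3.4 (c) p. 248] [cite: Kesten1963SAW, §4] [cite: DuminilCopinSmirnov2012, Theorem 1] -/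
theorem hexPolygonCountRatioTwo_rate :
    ∃ K : ℝ, ∃ m₁ : ℕ, ∀ m : ℕ, m₁ ≤ m →
      -K * (m : ℝ) ^ (-(1 : ℝ) / 3) ≤ (hexPolygonCount (2 * m + 4) : ℝ) / hexPolygonCount (2 * m + 2) - (2 + Real.sqrt 2) ∧
      (hexPolygonCount (2 * m + 4) : ℝ) / hexPolygonCount (2 * m + 2) - (2 + Real.sqrt 2) ≤ K * (m : ℝ) ^ (-(1 : ℝ) / 4) := by
  have hnb2 : hvGraph.Adj hvOrigin nb2 := (adj_hvOrigin_iff nb2).2 (Or.inr (Or.inr rfl))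
  obtain ⟨K, m₁, h⟩ := hexPolygonRatioTwo_rate hnb2
  refine ⟨K, m₁, fun m hm => ?_⟩
  rw [show 2 * m + 4 = (2 * m + 1 + 2) + 1 by ring, show 2 * m + 2 = (2 * m + 1) + 1 by ring,
    hexPolygonCount_eq_card_endFin, hexPolygonCount_eq_card_endFin]
  exact h m hm

end Rate

end Literature.Probability.RandomPlanarGeometry.SAW.HV

end
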